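import Summits.HubbardSuperconductivity.HubbardSuperconductivity.Theorems.WidthHaldaneKineticFloor

/-!
# The sharp Bloch price of a flux through the long cycle of the Hubbard tube

Support file for crux `WidthHaldaneBridge` (stmt-HubbardSuperconductivity-16311; routes `WidthHaldane`,
`SeamInduction`), line `Sketch` (card `twist-transfer-floors`): its registered kinematic stub
`stub_sharpBloch`, which is `UniformThermo`-free. For the pure Hubbard tube `ℤ/L × ℤ/M` (`L ≥ 3`,
`M ≥ 1`, any labelling `e`), every coupling `U`, flux `θ`, particle number `N` and every UNIT VECTOR
`ψ` of the sector `(N, S^z = 0)`,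

  `E_{L,M}(U; θ, N) ≤ Re⟨ψ, H₀ ψ⟩ + (1 - cos(θ/L)) · K_ψ`,
  `K_ψ = Σ_{a,b,σ} Re⟨ψ, (c†_{(a,b)σ} c_{(a-1,b)σ} + c†_{(a-1,b)σ} c_{(a,b)σ}) ψ⟩`

(the longitudinal kinetic energy of `ψ`, both orientations of every longitudinal bond). This is
Bloch's bound `WidthHaldaneTubeBlochBound.tubeEnergy_le_rayleigh_add` with the actual hopping
amplitudes of `ψ` kept instead of their a-priori bound `½`: price the gauge-rotated copies `W_{±θ}ᴴ ψ`
in `H₀ + Tw_{±θ}`, average the two orientations (`E(-θ) = E(θ)`, the bond currents cancel), and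
re-index the longitudinal ordered pairs by columns. The doubled inequality
`2E(θ) ≤ 2Re⟨ψ, H₀ψ⟩ + (2 - 2cos(θ/L))·K_ψ` is `WidthHaldaneKineticFloor.two_mul_tubeEnergy_le_kinetic`;
here we record the halved forms:

* `tubeEnergy_le_rayleigh_add_kinetic` — the displayed bound for every unit sector vector;
* `tubeEnergy_le_tubeEnergy_zero_add_kinetic` — `E(θ) ≤ E(0) + (1 - cos(θ/L))·K_ψ` for every
  normalised sector ground state `ψ` of the untwisted tube;
* `stub_sharpBloch` — the registered closed form (all binders universally quantified).

References: D. Bohm, Phys. Rev. 75 (1949) 502; H. Watanabe, J. Stat. Phys. 177 (2019) 717, §2.2.3,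
§4.1; D. J. Scalapino, S. R. White, S. C. Zhang, PRB 47 (1993) 7995, §II.
-/

noncomputable section

namespace Summit.HubbardSuperconductivity.HubbardSuperconductivity.Theorems.WidthHaldane

set_option linter.dupNamespace false -- summit = problem name (single-conjunct summit), D-0017

open scoped BigOperators Classical Matrix ComplexConjugate
open Matrix Literature.MathematicalPhysics.QuantumLattice

section SharpBloch

variable (L M : ℕ) [NeZero L] [NeZero M] (Λ : Type) [LinearOrder Λ] [Fintype Λ]
  (e : Λ ≃ ZMod L × ZMod M)

/-- **Sharp Bloch price for every unit sector vector** (`L ≥ 3`): for `ψ` a unit vector of the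
sector `(N, S^z = 0)`, `E_{L,M}(U; θ, N) ≤ Re⟨ψ, H₀ ψ⟩ + (1 - cos(θ/L)) · K_ψ` with `K_ψ` the
longitudinal kinetic energy of `ψ` in column coordinates (half of
`two_mul_tubeEnergy_le_kinetic`). [cite: Watanabe2019, §2.2.3 and §4.1] -/
theorem tubeEnergy_le_rayleigh_add_kinetic (hL : 3 ≤ L) (U θ : ℝ) (N : ℕ) {ψ : Fock (Orb Λ)}
    (hψ : ψ ∈ szSector N 0) (h1 : star ψ ⬝ᵥ ψ = 1) :
    tubeEnergy L M Λ e U θ N ≤ (expect (tubeH0 L M Λ e U) ψ).re +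
      (1 - Real.cos (θ / L)) * ∑ a : ZMod L, ∑ b : ZMod M, ∑ σ : Fin 2,
        (expect (creation (orb (e.symm (a, b)) σ) * annihilation (orb (e.symm (a - 1, b)) σ) +
          creation (orb (e.symm (a - 1, b)) σ) * annihilation (orb (e.symm (a, b)) σ)) ψ).re := by
  have h := two_mul_tubeEnergy_le_kinetic L M Λ e hL U θ N hψ h1
  linarith

/-- **Sharp Bloch price for a sector ground state** (`L ≥ 3`): for every normalised ground state `ψ`
of the untwisted tube in the sector `(N, S^z = 0)`, `E_{L,M}(U; θ, N) ≤ E_{L,M}(U; 0, N) +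
(1 - cos(θ/L)) · K_ψ` (Scalapino–White–Zhang's `D_s/π ≤ ⟨-k_x⟩` before the small-`θ` expansion).
[cite: ScalapinoWhiteZhang1993, §II] -/
theorem tubeEnergy_le_tubeEnergy_zero_add_kinetic (hL : 3 ≤ L) (U θ : ℝ) (N : ℕ) {ψ : Fock (Orb Λ)}
    (h1 : star ψ ⬝ᵥ ψ = 1) (hgs : IsGroundStateInSector (tubeH0 L M Λ e U) N 0 ψ) :
    tubeEnergy L M Λ e U θ N ≤ tubeEnergy L M Λ e U 0 N +
      (1 - Real.cos (θ / L)) * ∑ a : ZMod L, ∑ b : ZMod M, ∑ σ : Fin 2,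
        (expect (creation (orb (e.symm (a, b)) σ) * annihilation (orb (e.symm (a - 1, b)) σ) +
          creation (orb (e.symm (a - 1, b)) σ) * annihilation (orb (e.symm (a, b)) σ)) ψ).re := by
  have h := tubeEnergy_sub_le_kinetic L M Λ e hL U θ N h1 hgs
  linarith

end SharpBloch

/-- **SHARP BLOCH PRICE, closed form** (the registered stub `stub_sharpBloch` of line `Sketch` of
crux stmt-HubbardSuperconductivity-16311; all binders universally quantified): for `L ≥ 3`, every
`U, θ, N`, every labelling and every unit vector `ψ` of the sector `(N, S^z = 0)`,
`E_{L,M}(U; θ, N) ≤ Re⟨ψ, H₀ ψ⟩ + (1 - cos(θ/L)) · Σ_{a,b,σ} Re⟨ψ, (c†_{(a,b)σ} c_{(a-1,b)σ} +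
c†_{(a-1,b)σ} c_{(a,b)σ}) ψ⟩`. [cite: Watanabe2019, §2.2.3 and §4.1] -/
theorem stub_sharpBloch :
    ∀ (L M : ℕ) [NeZero L] [NeZero M] (Λ : Type) [LinearOrder Λ] [Fintype Λ] (e : Λ ≃ ZMod L × ZMod M),
      3 ≤ L → ∀ (U θ : ℝ) (N : ℕ) (ψ : Fock (Orb Λ)), ψ ∈ szSector N 0 → star ψ ⬝ᵥ ψ = 1 →
        tubeEnergy L M Λ e U θ N ≤
          (expect (tubeH0 L M Λ e U) ψ).re +
            (1 - Real.cos (θ / L)) *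
              ∑ a : ZMod L, ∑ b : ZMod M, ∑ σ : Fin 2,
                (expect (creation (orb (e.symm (a, b)) σ) * annihilation (orb (e.symm (a - 1, b)) σ) +
                  creation (orb (e.symm (a - 1, b)) σ) * annihilation (orb (e.symm (a, b)) σ)) ψ).re :=
  fun L M _ _ Λ _ _ e hL U θ N _ψ hψ h1 => tubeEnergy_le_rayleigh_add_kinetic L M Λ e hL U θ N hψ h1

end Summit.HubbardSuperconductivity.HubbardSuperconductivity.Theorems.WidthHaldane

end
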